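import Summits.ValiantsHypothesis.ValiantsHypothesis.Theorems.LacunarySymmetroidMatrixDescartesDoorA26WallBubblingHigherMinors

/-!
# Wall bubbling for `DoorA26` — minor rows GROUPED BY MONOMIAL and LEMMA L at the engine's PRESCRIBED fine scale (the lexicographic row as the LP disjunction)

LINE / STUBS.  Crux `Theses.LacunarySymmetroid.DoorA26` (stmt-ValiantsHypothesis-19979; OPEN, typed, never asserted), line `Cruxes/DoorA26/Lines/wall_bubbling.lean`
(val-idea-15), obligation (M) `Stmt.stub_mixedWalls`; instrument memo `Lines/wall_bubbling_M-sieve.md` rev 10 §7.3 R3 / §7.4 LEMMA L.  Two packaging points left open by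
W1 #20 `…WallBubblingLexRows` / #21 `…WallBubblingHigherMinors`, both raised on the bus (crit-2 g4 2026-08-28T20:54Z; crit-5 g3 20:22Z «matched literally»):

(1) MONOMIALS, NOT PERMUTATIONS.  The memo's row is the minor as a POLYNOMIAL `Σ_m c_m X^m` (coefficients collected: `c_m = Σ_{σ ↦ m} sgn σ`, e.g. `±2` in symmetric minors, and
    `0` for cancelling pairs), and its classes `T` are sets of MONOMIALS.  #21's composed rows index `T` by permutations; two permutations with the same monomial are distinct
    summands there, so the opposite-sign pair LEMMA L returns could be a cancelling pair — correct but useless.  Here the Leibniz sum is GROUPED by an arbitrary labelling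
    `cls : Perm (Fin r) → κ` supplied by the certificate (intended: `cls σ` = the monomial of `σ`), `X_k := Σ_{σ : cls σ = k} sgn σ · ∏_a G (ρ (σ a)) (γ a)` (= `c_m · G^m`):
    `realisable_minor_row_grouped` (`Σ_k X_k = 0`), `realisable_minor_row_grouped_split` (`Σ_{k:T} X_k + Σ_{k∉T} X_k = 0`), and the composed rows
    `realisable_minor_lexRowG_topClass` / `realisable_minor_lexRowG_card` / `realisable_minor_lexRowG_two` (LEMMA L (iii)/(i)/(ii) on monomial classes; `x`, `rest` through
    defining hypotheses `hxdef` / `hrdef`).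
(2) THE PRESCRIBED FINE SCALE.  #20 quantifies the finer scale AFTER choosing a subsequence.  The engine's R3 row is the other way round: the chain PRESCRIBES `w₁^ν → ∞`,
    carries for each top class its eventual SIGN `s_k` and either a real fine-height variable `φ_k = lim (log|x_k^ν| − log‖x^ν‖)/w₁^ν` (`k ∈ A`) or the verdict «`−∞` at the
    fine scale» (`k ∉ A`), and imposes the DISJUNCTION «some `k⁺ ∈ A` with `s = +1`, `φ = 0` and some `k⁻ ∈ A` with `s = −1`, `φ = 0`»: `lexRow_prescribed` (abstract, any finite
    index type) and `realisable_minor_lexRowG_prescribed` (a grouped minor row of a realisable sequence).  Proof: #20's subsequence + uniqueness of limits along it.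

Necessary conditions only; they kill nothing; nothing here bears on (M)/(W)/(R), on `DoorA26`, on `MatrixDescartes` (stmt-ValiantsHypothesis-18050) or on `VP ≠ VNP`; registers
unchanged.  Seat val-sym-door-p2 g12 (W1 #22), `--supports stmt-ValiantsHypothesis-19979 --as helper`. [folklore] regrouping finite sums; limits along subsequences. [this work] packaging.
-/

-- `Summit.ValiantsHypothesis.ValiantsHypothesis.…` repeats a component by the D-0017 layout
-- (single-conjunct summit), which the `dupNamespace` linter flags; the name is mandated.
set_option linter.dupNamespace false

namespace Summit.ValiantsHypothesis.ValiantsHypothesis.Theorems.LacunarySymmetroidMatrixDescartes.WallBubbling.SecondOrder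

open Finset Filter Topology
open scoped BigOperators
open Summit.ValiantsHypothesis.ValiantsHypothesis.Theorems.LacunarySymmetroidMatrixDescartes.WallBubbling.Bubbling

/-! ## §1 Minor rows grouped by an arbitrary labelling of the permutations (intended: by monomial) -/

/-- **Grouped minor row**: for realisable `G`, `r ≥ 4`, a minor `(ρ, γ)` and any labelling `cls` of the permutations,
`Σ_k (Σ_{σ : cls σ = k} sgn σ · ∏_a G (ρ (σ a)) (γ a)) = 0`. [folklore] -/
theorem realisable_minor_row_grouped {κ : Type*} [Fintype κ] [DecidableEq κ] {G : Matrix (Fin 6) (Fin 6) ℝ} (hG : Realisable G)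
    {r : ℕ} (hr : 3 < r) (ρ γ : Fin r → Fin 6) (cls : Equiv.Perm (Fin r) → κ) :
    ∑ k, ∑ σ ∈ Finset.univ.filter (fun σ => cls σ = k), ((Equiv.Perm.sign σ : ℤ) : ℝ) * ∏ a, G (ρ (σ a)) (γ a) = 0 := by
  rw [Finset.sum_fiberwise_of_maps_to (fun σ _ => Finset.mem_univ (cls σ))]
  exact realisable_minor_row hG hr ρ γ

/-- **Grouped minor row split at a class `T` of labels**: `Σ_{k : T} X_k + Σ_{k ∉ T} X_k = 0`. [this work] -/
theorem realisable_minor_row_grouped_split {κ : Type*} [Fintype κ] [DecidableEq κ] {G : Matrix (Fin 6) (Fin 6) ℝ} (hG : Realisable G)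
    {r : ℕ} (hr : 3 < r) (ρ γ : Fin r → Fin 6) (cls : Equiv.Perm (Fin r) → κ) (T : Finset κ) :
    ∑ k : T, ∑ σ ∈ Finset.univ.filter (fun σ => cls σ = (k : κ)), ((Equiv.Perm.sign σ : ℤ) : ℝ) * ∏ a, G (ρ (σ a)) (γ a) +
      ∑ k ∈ Tᶜ, ∑ σ ∈ Finset.univ.filter (fun σ => cls σ = k), ((Equiv.Perm.sign σ : ℤ) : ℝ) * ∏ a, G (ρ (σ a)) (γ a) = 0 := by
  rw [Finset.sum_coe_sort T (fun k => ∑ σ ∈ Finset.univ.filter (fun σ => cls σ = k),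
      ((Equiv.Perm.sign σ : ℤ) : ℝ) * ∏ a, G (ρ (σ a)) (γ a)), Finset.sum_add_sum_compl]
  exact realisable_minor_row_grouped hG hr ρ γ cls

/-- **Grouped minor row, top-class form (LEMMA L (iii) on monomial classes).**  Realisable sequence, minor, labelling `cls`, top labels `T` with grouped values
`x^ν_k = Σ_{σ : cls σ = k} sgn σ · ∏_a G^ν (ρ (σ a)) (γ a)` not identically zero and DOMINATING the rest ⇒ along a subsequence two labels `k ≠ k'` in `T` of opposite eventual sign and
relative fine height `0` at every finer scale. [this work] -/
theorem realisable_minor_lexRowG_topClass {κ : Type*} [Fintype κ] [DecidableEq κ] (G : ℕ → Matrix (Fin 6) (Fin 6) ℝ) (hG : ∀ ν, Realisable (G ν))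
    {r : ℕ} (hr : 3 < r) (ρ γ : Fin r → Fin 6) (cls : Equiv.Perm (Fin r) → κ) (T : Finset κ) (x : ℕ → T → ℝ) (rest : ℕ → ℝ)
    (hxdef : ∀ ν (k : T), x ν k = ∑ σ ∈ Finset.univ.filter (fun σ => cls σ = (k : κ)), ((Equiv.Perm.sign σ : ℤ) : ℝ) * ∏ a, G ν (ρ (σ a)) (γ a))
    (hrdef : ∀ ν, rest ν = ∑ k ∈ Tᶜ, ∑ σ ∈ Finset.univ.filter (fun σ => cls σ = k), ((Equiv.Perm.sign σ : ℤ) : ℝ) * ∏ a, G ν (ρ (σ a)) (γ a))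
    (hx : ∀ ν, x ν ≠ 0) (hdom : Tendsto (fun ν => rest ν / ‖x ν‖) atTop (𝓝 0)) :
    ∃ φ : ℕ → ℕ, StrictMono φ ∧ ∃ k k' : T, k ≠ k' ∧
      (∀ᶠ n in atTop, 0 < x (φ n) k) ∧ (∀ᶠ n in atTop, x (φ n) k' < 0) ∧
      ∀ w : ℕ → ℝ, Tendsto w atTop atTop →
        Tendsto (fun n => (Real.log |x (φ n) k| - Real.log ‖x (φ n)‖) / w n) atTop (𝓝 0) ∧
        Tendsto (fun n => (Real.log |x (φ n) k'| - Real.log ‖x (φ n)‖) / w n) atTop (𝓝 0) := by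
  have hsum : ∀ ν, ∑ k, x ν k + rest ν = 0 := by
    intro ν
    rw [hrdef ν, Fintype.sum_congr _ _ (hxdef ν)]
    exact realisable_minor_row_grouped_split (hG ν) hr ρ γ cls T
  exact lexRow_topClass x rest hsum hx hdom

/-- **Grouped minor row, one-scale form (LEMMA L (i))**: under the same hypotheses `T` has at least two labels. [this work] -/
theorem realisable_minor_lexRowG_card {κ : Type*} [Fintype κ] [DecidableEq κ] (G : ℕ → Matrix (Fin 6) (Fin 6) ℝ) (hG : ∀ ν, Realisable (G ν))
    {r : ℕ} (hr : 3 < r) (ρ γ : Fin r → Fin 6) (cls : Equiv.Perm (Fin r) → κ) (T : Finset κ) (x : ℕ → T → ℝ) (rest : ℕ → ℝ)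
    (hxdef : ∀ ν (k : T), x ν k = ∑ σ ∈ Finset.univ.filter (fun σ => cls σ = (k : κ)), ((Equiv.Perm.sign σ : ℤ) : ℝ) * ∏ a, G ν (ρ (σ a)) (γ a))
    (hrdef : ∀ ν, rest ν = ∑ k ∈ Tᶜ, ∑ σ ∈ Finset.univ.filter (fun σ => cls σ = k), ((Equiv.Perm.sign σ : ℤ) : ℝ) * ∏ a, G ν (ρ (σ a)) (γ a))
    (hx : ∀ ν, x ν ≠ 0) (hdom : Tendsto (fun ν => rest ν / ‖x ν‖) atTop (𝓝 0)) : 1 < T.card := by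
  have hsum : ∀ ν, ∑ k, x ν k + rest ν = 0 := by
    intro ν
    rw [hrdef ν, Fintype.sum_congr _ _ (hxdef ν)]
    exact realisable_minor_row_grouped_split (hG ν) hr ρ γ cls T
  have h := lexRow_card_top x rest hsum hx hdom
  rwa [Fintype.card_coe] at h

/-- **Grouped minor row, two-class form (LEMMA L (ii))**: top labels `k₁ ≠ k₂`, `x = X_{k₁}`, `y = X_{k₂}`, rest = the other labels, dominated by `max(|x|,|y|)` (positive eventually) ⇒
opposite signs eventually, `|x|/|y| → 1`, `log|x| − log|y| → 0` along the whole sequence. [this work] -/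
theorem realisable_minor_lexRowG_two {κ : Type*} [Fintype κ] [DecidableEq κ] (G : ℕ → Matrix (Fin 6) (Fin 6) ℝ) (hG : ∀ ν, Realisable (G ν))
    {r : ℕ} (hr : 3 < r) (ρ γ : Fin r → Fin 6) (cls : Equiv.Perm (Fin r) → κ) (k₁ k₂ : κ) (hne : k₁ ≠ k₂) (x y rest : ℕ → ℝ)
    (hxdef : ∀ ν, x ν = ∑ σ ∈ Finset.univ.filter (fun σ => cls σ = k₁), ((Equiv.Perm.sign σ : ℤ) : ℝ) * ∏ a, G ν (ρ (σ a)) (γ a))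
    (hydef : ∀ ν, y ν = ∑ σ ∈ Finset.univ.filter (fun σ => cls σ = k₂), ((Equiv.Perm.sign σ : ℤ) : ℝ) * ∏ a, G ν (ρ (σ a)) (γ a))
    (hrdef : ∀ ν, rest ν = ∑ k ∈ ({k₁, k₂} : Finset κ)ᶜ, ∑ σ ∈ Finset.univ.filter (fun σ => cls σ = k),
      ((Equiv.Perm.sign σ : ℤ) : ℝ) * ∏ a, G ν (ρ (σ a)) (γ a))
    (hpos : ∀ᶠ ν in atTop, 0 < max |x ν| |y ν|) (hdom : Tendsto (fun ν => rest ν / max |x ν| |y ν|) atTop (𝓝 0)) :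
    (∀ᶠ ν in atTop, x ν * y ν < 0) ∧ Tendsto (fun ν => |x ν| / |y ν|) atTop (𝓝 1) ∧
      Tendsto (fun ν => Real.log |x ν| - Real.log |y ν|) atTop (𝓝 0) := by
  have hsum : ∀ ν, x ν + y ν + rest ν = 0 := by
    intro ν
    have h := realisable_minor_row_grouped (hG ν) hr ρ γ cls
    rw [← Finset.sum_add_sum_compl ({k₁, k₂} : Finset κ), Finset.sum_pair hne] at h
    rw [hxdef, hydef, hrdef]
    exact h
  obtain ⟨h1, h2⟩ := lexRow_two x y rest hsum hpos hdom
  exact ⟨h1, h2, lexRow_two_log x y rest hsum hpos hdom⟩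

/-! ## §2 LEMMA L at a prescribed fine scale -/

/-- **LEMMA L (iii) at a PRESCRIBED fine scale — the engine's lexicographic row.**  Top values `x^ν : ι → ℝ` (`≠ 0`), rest `r^ν`, row `Σ_i x^ν_i + r^ν = 0`, DOMINATION
`r^ν/‖x^ν‖ → 0`; eventual signs `sign x^ν_i = s_i`; a fine scale `w^ν → ∞`; for `i ∈ A` the relative fine height `(log|x^ν_i| − log‖x^ν‖)/w^ν → φ_i`, for `i ∉ A` it tends to `−∞`.
Then some `i ∈ A` has `φ_i = 0`, `s_i = 1` and some `j ∈ A` has `φ_j = 0`, `s_j = −1`. [this work] -/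
theorem lexRow_prescribed {ι : Type*} [Fintype ι] (x : ℕ → ι → ℝ) (r : ℕ → ℝ)
    (hsum : ∀ ν, ∑ i, x ν i + r ν = 0) (hx : ∀ ν, x ν ≠ 0)
    (hr : Tendsto (fun ν => r ν / ‖x ν‖) atTop (𝓝 0))
    (s : ι → ℝ) (hs : ∀ i, ∀ᶠ ν in atTop, Real.sign (x ν i) = s i)
    (w : ℕ → ℝ) (hw : Tendsto w atTop atTop) (A : Finset ι) (φ : ι → ℝ)
    (hφ : ∀ i ∈ A, Tendsto (fun ν => (Real.log |x ν i| - Real.log ‖x ν‖) / w ν) atTop (𝓝 (φ i)))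
    (hA : ∀ i ∉ A, Tendsto (fun ν => (Real.log |x ν i| - Real.log ‖x ν‖) / w ν) atTop atBot) :
    ∃ i ∈ A, ∃ j ∈ A, φ i = 0 ∧ φ j = 0 ∧ s i = 1 ∧ s j = -1 := by
  obtain ⟨ψ, hψ, i, j, -, hpos, hneg, hfine⟩ := lexRow_topClass x r hsum hx hr
  have hwψ : Tendsto (fun k => w (ψ k)) atTop atTop := hw.comp hψ.tendsto_atTop
  obtain ⟨hi0, hj0⟩ := hfine (fun k => w (ψ k)) hwψ
  -- membership in `A`: a relative fine height cannot tend to `0` and to `−∞` along `ψ`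
  have memA : ∀ m, Tendsto (fun k => (Real.log |x (ψ k) m| - Real.log ‖x (ψ k)‖) / w (ψ k)) atTop (𝓝 0) → m ∈ A := by
    intro m hm
    by_contra hmA
    have hbot := (hA m hmA).comp hψ.tendsto_atTop
    have h1 : ∀ᶠ k in atTop, (Real.log |x (ψ k) m| - Real.log ‖x (ψ k)‖) / w (ψ k) < -1 :=
      hbot.eventually (eventually_lt_atBot (-1))
    have h2 : ∀ᶠ k in atTop, (-1 : ℝ) < (Real.log |x (ψ k) m| - Real.log ‖x (ψ k)‖) / w (ψ k) :=
      hm.eventually (lt_mem_nhds (by norm_num : (-1 : ℝ) < 0))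
    obtain ⟨k, hk1, hk2⟩ := (h1.and h2).exists
    exact absurd (hk1.trans hk2) (lt_irrefl _)
  have hiA : i ∈ A := memA i hi0
  have hjA : j ∈ A := memA j hj0
  have hφi : φ i = 0 := tendsto_nhds_unique ((hφ i hiA).comp hψ.tendsto_atTop) hi0
  have hφj : φ j = 0 := tendsto_nhds_unique ((hφ j hjA).comp hψ.tendsto_atTop) hj0
  have hsi : s i = 1 := by
    obtain ⟨k, hk1, hk2⟩ := ((hψ.tendsto_atTop.eventually (hs i)).and hpos).exists
    rw [← hk1, Real.sign_of_pos hk2]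
  have hsj : s j = -1 := by
    obtain ⟨k, hk1, hk2⟩ := ((hψ.tendsto_atTop.eventually (hs j)).and hneg).exists
    rw [← hk1, Real.sign_of_neg hk2]
  exact ⟨i, hiA, j, hjA, hφi, hφj, hsi, hsj⟩

/-- **Grouped MINOR ROW at a PRESCRIBED fine scale** (the engine's R3 row for a minor of a realisable sequence, classes = labels / monomials): grouped top values `x` on `T`
(`hxdef`) not identically zero and DOMINATING the rest, eventual signs `s`, a fine scale `w → ∞`, fine heights `φ` on `A ⊆ T`, `−∞` off `A` ⇒
`∃ k ∈ A, ∃ k' ∈ A, φ k = 0 ∧ φ k' = 0 ∧ s k = 1 ∧ s k' = −1`. [this work] -/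
theorem realisable_minor_lexRowG_prescribed {κ : Type*} [Fintype κ] [DecidableEq κ] (G : ℕ → Matrix (Fin 6) (Fin 6) ℝ) (hG : ∀ ν, Realisable (G ν))
    {r : ℕ} (hr : 3 < r) (ρ γ : Fin r → Fin 6) (cls : Equiv.Perm (Fin r) → κ) (T : Finset κ) (x : ℕ → T → ℝ) (rest : ℕ → ℝ)
    (hxdef : ∀ ν (k : T), x ν k = ∑ σ ∈ Finset.univ.filter (fun σ => cls σ = (k : κ)), ((Equiv.Perm.sign σ : ℤ) : ℝ) * ∏ a, G ν (ρ (σ a)) (γ a))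
    (hrdef : ∀ ν, rest ν = ∑ k ∈ Tᶜ, ∑ σ ∈ Finset.univ.filter (fun σ => cls σ = k), ((Equiv.Perm.sign σ : ℤ) : ℝ) * ∏ a, G ν (ρ (σ a)) (γ a))
    (hx : ∀ ν, x ν ≠ 0) (hdom : Tendsto (fun ν => rest ν / ‖x ν‖) atTop (𝓝 0))
    (s : T → ℝ) (hs : ∀ k, ∀ᶠ ν in atTop, Real.sign (x ν k) = s k)
    (w : ℕ → ℝ) (hw : Tendsto w atTop atTop) (A : Finset T) (φ : T → ℝ)
    (hφ : ∀ k ∈ A, Tendsto (fun ν => (Real.log |x ν k| - Real.log ‖x ν‖) / w ν) atTop (𝓝 (φ k)))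
    (hA : ∀ k ∉ A, Tendsto (fun ν => (Real.log |x ν k| - Real.log ‖x ν‖) / w ν) atTop atBot) :
    ∃ k ∈ A, ∃ k' ∈ A, φ k = 0 ∧ φ k' = 0 ∧ s k = 1 ∧ s k' = -1 := by
  have hsum : ∀ ν, ∑ k, x ν k + rest ν = 0 := by
    intro ν
    rw [hrdef ν, Fintype.sum_congr _ _ (hxdef ν)]
    exact realisable_minor_row_grouped_split (hG ν) hr ρ γ cls T
  exact lexRow_prescribed x rest hsum hx hdom s hs w hw A φ hφ hA

end Summit.ValiantsHypothesis.ValiantsHypothesis.Theorems.LacunarySymmetroidMatrixDescartes.WallBubbling.SecondOrder
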